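import Mathlib
import HarnessLib
import Literature.Analysis.FluidPDE.ParabolicComparison

/-!
# Item `LrcModEntire` (stmt-NavierStokesRegularity-20428), CLASS road to `stub_twistingTHGerm` — the SLOPE DICTIONARY on proportional-shear planes:
# the slope `μ(c)` and its height-derivative `μ′(c)` are ratios of Jacobian / Hessian entries at ANY non-flat point of the plane

Cell ns-regularity-ideate, LEAD ns-poloidal-K2-p3 g13 (`--supports stmt-NavierStokesRegularity-20428`; memo OSC-LIOUVILLE-g13 v1.5 §5septies: the wall (BRANCH) needs
polynomial bounds on `μ, μ_z, …`, which by this dictionary follow from UNIFORM NON-FLATNESS — one point per plane with `|∂_b u₂| ≳ g₀/(−t)` — and the Type-I derivative bounds).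

For a `C²` field `u : ℝ³ → ℝ³` and a slope FUNCTION `μ : ℝ → ℝ` of the height such that the planes near height `c` are proportional-shear,
`(∂₂u)_b(y) = μ(y₂)·(∂_b u)₂(y)` (`b = 0,1`) for all `y` with `y₂` near `c`, and a witness point `y` (`y₂ = c`) with `(∂_b u)₂(y) ≠ 0`:
* `slope_eq_ratio` — `μ(c) = (∂₂u)_b(y) / (∂_b u)₂(y)`;
* `abs_slope_le` — `|μ(c)| ≤ K₁ / g` whenever `|(∂₂u)_b(y)| ≤ K₁` and `g ≤ |(∂_b u)₂(y)|`;
* `deriv_slope_mul_eq` — if `μ` is differentiable at `c`: `μ′(c)·(∂_b u)₂(y) = (∂₂∂₂u)_b(y) − μ(c)·(∂₂∂_b u)₂(y)` (differentiate the plane identity along the vertical line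
  through `y`);
* `abs_deriv_slope_le` — hence `|μ′(c)| ≤ (K₂ + |μ(c)|·K₂) / g` whenever the two second derivatives are bounded by `K₂` and `g ≤ |(∂_b u)₂(y)|`.
Pure calculus (chain/product rules along the vertical line); no Navier–Stokes input.  With the class rate `‖Du‖ ≤ C₁/(−t)`, `‖D²u‖ ≤ C₂/(−t)^{3/2}` this reads: in similarity
units the slope and its gradient are controlled by the inverse of the plane's best horizontal gradient of `u₂` — slope inflation ⟺ flattening of planes.

WHAT THIS IS NOT: not a claim about Navier–Stokes regularity and not the stub (bears_on LADDER-NS N0, item 20428 / crux 19708; both OPEN).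
-/

noncomputable section

-- the summit and its single sub-problem share the name (CONVENTIONS §1), as in every Theorems file
set_option linter.dupNamespace false

namespace Summit.NavierStokesRegularity.NavierStokesRegularity.Theorems.PoloidalWindowDoorLrcModEntireTwistingTHSlopeDictionary

open Set Filter Topology
open Literature.Analysis.FluidPDE

variable {u : EuclideanSpace ℝ (Fin 3) → EuclideanSpace ℝ (Fin 3)} {μ : ℝ → ℝ} {c : ℝ} {y : EuclideanSpace ℝ (Fin 3)} {b : Fin 3}

/-- **The slope is a Jacobian ratio at any non-flat point of the plane.** -/
theorem slope_eq_ratio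
    (hslope : ∀ y' : EuclideanSpace ℝ (Fin 3), y' 2 = c → ∀ b' : Fin 3, b' ≠ 2 →
      fderiv ℝ u y' (EuclideanSpace.single 2 1) b' = μ c * fderiv ℝ u y' (EuclideanSpace.single b' 1) 2)
    (hy : y 2 = c) (hb : b ≠ 2) (hne : fderiv ℝ u y (EuclideanSpace.single b 1) 2 ≠ 0) :
    μ c = fderiv ℝ u y (EuclideanSpace.single 2 1) b / fderiv ℝ u y (EuclideanSpace.single b 1) 2 := by
  rw [eq_div_iff hne]
  exact (hslope y hy b hb).symm

/-- **Bound on the slope from one non-flat point**: `|μ(c)| ≤ K₁/g` if `|(∂₂u)_b(y)| ≤ K₁` and `0 < g ≤ |(∂_b u)₂(y)|`. -/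
theorem abs_slope_le {K₁ g : ℝ}
    (hslope : ∀ y' : EuclideanSpace ℝ (Fin 3), y' 2 = c → ∀ b' : Fin 3, b' ≠ 2 →
      fderiv ℝ u y' (EuclideanSpace.single 2 1) b' = μ c * fderiv ℝ u y' (EuclideanSpace.single b' 1) 2)
    (hy : y 2 = c) (hb : b ≠ 2) (hg : 0 < g) (hgle : g ≤ |fderiv ℝ u y (EuclideanSpace.single b 1) 2|)
    (hK : |fderiv ℝ u y (EuclideanSpace.single 2 1) b| ≤ K₁) :
    |μ c| ≤ K₁ / g := by
  have hne : fderiv ℝ u y (EuclideanSpace.single b 1) 2 ≠ 0 := fun h => by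
    rw [h, abs_zero] at hgle; linarith
  rw [slope_eq_ratio hslope hy hb hne, abs_div]
  have hpos : 0 < |fderiv ℝ u y (EuclideanSpace.single b 1) 2| := abs_pos.2 hne
  rw [div_le_div_iff₀ hpos hg]
  calc |fderiv ℝ u y (EuclideanSpace.single 2 1) b| * g ≤ K₁ * g := mul_le_mul_of_nonneg_right hK hg.le
    _ ≤ K₁ * |fderiv ℝ u y (EuclideanSpace.single b 1) 2| :=
        mul_le_mul_of_nonneg_left hgle ((abs_nonneg _).trans hK)

/-- **The height-derivative of the slope**: if the planes of all heights near `c` are proportional-shear with slope `μ(·)`, `μ` is differentiable at `c` and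
`u ∈ C²`, then at any point `y` of the plane `c`:  `μ′(c)·(∂_b u)₂(y) = (∂₂∂₂u)_b(y) − μ(c)·(∂₂∂_b u)₂(y)`. -/
theorem deriv_slope_mul_eq (hu : ContDiff ℝ 2 u)
    (hslope : ∀ᶠ c' in 𝓝 c, ∀ y' : EuclideanSpace ℝ (Fin 3), y' 2 = c' → ∀ b' : Fin 3, b' ≠ 2 →
      fderiv ℝ u y' (EuclideanSpace.single 2 1) b' = μ c' * fderiv ℝ u y' (EuclideanSpace.single b' 1) 2)
    (hμ : DifferentiableAt ℝ μ c) (hy : y 2 = c) (hb : b ≠ 2) :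
    deriv μ c * fderiv ℝ u y (EuclideanSpace.single b 1) 2 =
      fderiv ℝ (fun x => fderiv ℝ u x (EuclideanSpace.single 2 1) b) y (EuclideanSpace.single 2 1) -
        μ c * fderiv ℝ (fun x => fderiv ℝ u x (EuclideanSpace.single b 1) 2) y (EuclideanSpace.single 2 1) := by
  set e₂ : EuclideanSpace ℝ (Fin 3) := EuclideanSpace.single 2 (1 : ℝ) with he₂
  set eb : EuclideanSpace ℝ (Fin 3) := EuclideanSpace.single b (1 : ℝ) with heb
  -- the two Jacobian entries as functions on `ℝ³`, differentiable (u ∈ C²)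
  set F : EuclideanSpace ℝ (Fin 3) → ℝ := fun x => fderiv ℝ u x e₂ b with hF
  set G : EuclideanSpace ℝ (Fin 3) → ℝ := fun x => fderiv ℝ u x eb 2 with hG
  have hD1 : ContDiff ℝ 1 (fderiv ℝ u) := hu.fderiv_right (m := 1) le_rfl
  have hFd : Differentiable ℝ F := by
    have h : ContDiff ℝ 1 fun x => fderiv ℝ u x e₂ := hD1.clm_apply contDiff_const
    exact fun x => (EuclideanSpace.proj (𝕜 := ℝ) b).differentiableAt.comp x ((h.differentiable one_ne_zero) x)
  have hGd : Differentiable ℝ G := by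
    have h : ContDiff ℝ 1 fun x => fderiv ℝ u x eb := hD1.clm_apply contDiff_const
    exact fun x => (EuclideanSpace.proj (𝕜 := ℝ) (2 : Fin 3)).differentiableAt.comp x ((h.differentiable one_ne_zero) x)
  -- along the vertical line `s ↦ y + s e₂` (height `c + s`) the plane identity reads `F = μ(c+s)·G`
  have hline2 : ∀ s : ℝ, (y + s • e₂) 2 = c + s := by intro s; simp [he₂, hy]
  have hident : ∀ᶠ s in 𝓝 (0 : ℝ), F (y + s • e₂) - μ (c + s) * G (y + s • e₂) = 0 := by
    have hcs : Tendsto (fun s : ℝ => c + s) (𝓝 0) (𝓝 c) := by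
      have h : Continuous (fun s : ℝ => c + s) := by fun_prop
      simpa using h.tendsto 0
    filter_upwards [hcs.eventually hslope] with s hs
    have h := hs (y + s • e₂) (hline2 s) b hb
    simp only [hF, hG]
    linarith
  -- derivative of the identically-zero function at `s = 0`
  have hFl : HasDerivAt (fun s : ℝ => F (y + s • e₂)) (fderiv ℝ F y e₂) 0 := by
    have h := hasDerivAt_comp_line hFd y e₂ 0
    rwa [zero_smul, add_zero] at h
  have hGl : HasDerivAt (fun s : ℝ => G (y + s • e₂)) (fderiv ℝ G y e₂) 0 := by
    have h := hasDerivAt_comp_line hGd y e₂ 0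
    rwa [zero_smul, add_zero] at h
  have hμl : HasDerivAt (fun s : ℝ => μ (c + s)) (deriv μ c) 0 := by
    have h1 : HasDerivAt (fun s : ℝ => c + s) 1 0 := by simpa using (hasDerivAt_id (0 : ℝ)).const_add c
    have h2 : HasDerivAt μ (deriv μ c) (c + 0) := by rw [add_zero]; exact hμ.hasDerivAt
    have h3 : HasDerivAt (fun s : ℝ => μ (c + s)) (deriv μ c * 1) 0 := h2.comp 0 h1
    rwa [mul_one] at h3
  have hprod := hμl.mul hGl
  have hdiff := hFl.sub hprod
  have hzero : HasDerivAt (fun s : ℝ => F (y + s • e₂) - μ (c + s) * G (y + s • e₂)) 0 0 :=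
    (hasDerivAt_const (0 : ℝ) (0 : ℝ)).congr_of_eventuallyEq hident
  have huniq := hdiff.unique hzero
  simp only [zero_smul, add_zero] at huniq
  -- `fderiv F y e₂ − (μ′(c)·G(y) + μ(c)·fderiv G y e₂) = 0`
  have e : deriv μ c * G y = fderiv ℝ F y e₂ - μ c * fderiv ℝ G y e₂ := by linarith
  simpa [hF, hG] using e

/-- **Bound on the slope gradient from one non-flat point**: with `|(∂₂∂₂u)_b(y)|, |(∂₂∂_b u)₂(y)| ≤ K₂` and `0 < g ≤ |(∂_b u)₂(y)|`,
`|μ′(c)| ≤ (K₂ + |μ(c)|·K₂) / g`. -/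
theorem abs_deriv_slope_le {K₂ g : ℝ} (hu : ContDiff ℝ 2 u)
    (hslope : ∀ᶠ c' in 𝓝 c, ∀ y' : EuclideanSpace ℝ (Fin 3), y' 2 = c' → ∀ b' : Fin 3, b' ≠ 2 →
      fderiv ℝ u y' (EuclideanSpace.single 2 1) b' = μ c' * fderiv ℝ u y' (EuclideanSpace.single b' 1) 2)
    (hμ : DifferentiableAt ℝ μ c) (hy : y 2 = c) (hb : b ≠ 2) (hg : 0 < g) (hgle : g ≤ |fderiv ℝ u y (EuclideanSpace.single b 1) 2|)
    (hK1 : |fderiv ℝ (fun x => fderiv ℝ u x (EuclideanSpace.single 2 1) b) y (EuclideanSpace.single 2 1)| ≤ K₂)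
    (hK2 : |fderiv ℝ (fun x => fderiv ℝ u x (EuclideanSpace.single b 1) 2) y (EuclideanSpace.single 2 1)| ≤ K₂) :
    |deriv μ c| ≤ (K₂ + |μ c| * K₂) / g := by
  have hid := deriv_slope_mul_eq hu hslope hμ hy hb
  have hpos : 0 < |fderiv ℝ u y (EuclideanSpace.single b 1) 2| := lt_of_lt_of_le hg hgle
  rw [le_div_iff₀ hg]
  have h1 : |deriv μ c| * |fderiv ℝ u y (EuclideanSpace.single b 1) 2| ≤ K₂ + |μ c| * K₂ := by
    rw [← abs_mul, hid]
    calc |fderiv ℝ (fun x => fderiv ℝ u x (EuclideanSpace.single 2 1) b) y (EuclideanSpace.single 2 1) -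
            μ c * fderiv ℝ (fun x => fderiv ℝ u x (EuclideanSpace.single b 1) 2) y (EuclideanSpace.single 2 1)|
        ≤ |fderiv ℝ (fun x => fderiv ℝ u x (EuclideanSpace.single 2 1) b) y (EuclideanSpace.single 2 1)| +
            |μ c * fderiv ℝ (fun x => fderiv ℝ u x (EuclideanSpace.single b 1) 2) y (EuclideanSpace.single 2 1)| := abs_sub _ _
      _ ≤ K₂ + |μ c| * K₂ := by
          rw [abs_mul]; exact add_le_add hK1 (mul_le_mul_of_nonneg_left hK2 (abs_nonneg _))
  calc |deriv μ c| * g ≤ |deriv μ c| * |fderiv ℝ u y (EuclideanSpace.single b 1) 2| :=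
        mul_le_mul_of_nonneg_left hgle (abs_nonneg _)
    _ ≤ K₂ + |μ c| * K₂ := h1

end Summit.NavierStokesRegularity.NavierStokesRegularity.Theorems.PoloidalWindowDoorLrcModEntireTwistingTHSlopeDictionary
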